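import Summits.BirchSwinnertonDyer.BirchSwinnertonDyer.Theorems.GenusKolyvaginAtTwoPowDvdShaCardAtTwoRTRungSupplyKolyvagin
import Summits.BirchSwinnertonDyer.BirchSwinnertonDyer.Theorems.GenusKolyvaginAtTwoPowDvdShaCardAtTwoRTPrimeSwapping
import HarnessLib

/-!
# Route `GenusKolyvaginAtTwo`, LINE 18 (L_T `PowDvdShaCardAtTwoRT`, stmt-BirchSwinnertonDyer-23242), stub L
# `stub_twinShaLaddersAtTwo` — THE SUPPLY OF A RUNG FROM SEPARATION (McCallum's «`k = r`»: the own primes of `n` separate `C`)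

Seat `bsd-line-gk2-p2` g18 (PROVER seat 2/3, cell `bsd-f1-sign2`), `--supports stmt-BirchSwinnertonDyer-23242` (helper; closes
nothing). THEOREMS ONLY (no definition, no named fact, no `sorry`); BSD is not proved by any of this.

WHY. `…RTRungSupplyShape` takes McCallum's Prop. 5.2 at `2` with the conclusion «`⟨c_L(n)⟩ ∩ C = 0`». McCallum's proof ends
differently (held `book:editornd-l-functions-arithmetic` p0287): after the prime swaps, the Frobenius characters of the own primes
`ℓ ∣ n` generate `C^*`, i.e. **`{c ∈ C : c_λ = 0 for all ℓ ∣ n} = 0`** (SEPARATION), and «since `c_{M_{r−1}}(n)_λ = 0` for all `ℓ ∈ S`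
(Prop. 4.4), `C ∩ ⟨c_{M_{r−1}}(n)⟩ = 0`». The route's loop (`exists_good_separating_of_swapOracle`, gk2-p2 g15; `…_of_twoPrimeReciprocity`,
LEAD g15) outputs exactly a separating set of good primes, `C ⊓ (⨅_{ℓ ∈ S} A ℓ) = ⊥`. This file closes the gap between that output and
the avoidance binders of the descent layer, in `kolyvaginClass` currency:

* §1 **`zsmul_kolyvaginClass_two_mem_torsionLocalKer`** — own-prime vanishing of the supply element: if `2^j c_L(n/ℓ) = 0` (data at
  `n/ℓ` coherent with the datum at `n`) then `loc_v (2^j c_L(n)) = 0` at every `v ∣ ℓ ∣ n` (Q2 `KolyvaginRelationAtTwo` BY NAME, second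
  clause).
* §2 **`avoidance_of_kolyvaginSupply_of_separation`** — Prop. 5.2 at `2` in SEPARATION form (hypothesis `hP52sep`: … and
  `(⟨u⟩ ⊔ C₀) ⊓ ⨅_{ℓ ∣ n} ⨅_{v ∣ ℓ} ker loc_v = ⊥`) ⟹ the avoidance binder of `…RTRungFamilies` / `…RTTwinShaLaddersOfSupplies`
  (general sign `ε`, seed `C₀`), the avoiding element being `2^{L−M'} c_L(n)` (`exists_supplyElement_of_kolyvaginDatum` +
  `disjoint_zmultiples_of_forall_mem`).

References: [McCallumLMS1991] §5 Prop. 5.2 (proof, last paragraph of p. 310 = held p0287), Prop. 4.4; [GrossLMS1991] Prop. 6.2 (2).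
-/

set_option autoImplicit false
-- the Theorems namespace of this sub repeats the summit name by design (D-0017 nested layout)
set_option linter.dupNamespace false

noncomputable section

open scoped Classical

namespace Summit.BirchSwinnertonDyer.BirchSwinnertonDyer.Theorems.GenusExact.PlusDescent

open WeierstrassCurve NumberField IsDedekindDomain Field Literature.NumberTheory.EllipticCurves
  Literature.NumberTheory.GaloisRepresentations Literature.NumberTheory.EllipticCurves.ModularForms AddSubgroup
open Summit.BirchSwinnertonDyer.BirchSwinnertonDyer.Theses.GenusKolyvaginAtTwo (KolyvaginRelationAtTwo)
open Summit.BirchSwinnertonDyer.Rank1Residual.JET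

variable {K : Type} [Field K] [NumberField K] (W : WeierstrassCurve ℚ) [W.IsElliptic] [W.IsGloballyMinimal]
  [NeZero (W.conductorNorm ℤ)] (Dt : ModularParametrizationData W (W.conductorNorm ℤ)) (β : ℤ) (ι : K →+* ℂ)
  (τ : K ≃ₐ[ℚ] K) (L : ℕ)

/-! ## §1 Own-prime vanishing of the supply element -/

/-- **`loc_v (2^j c_L(n)) = 0` at `v ∣ ℓ ∣ n` when `2^j c_L(n/ℓ) = 0`** (McCallum Prop. 4.4 «in particular» = Q2, second clause:
`loc_v(2^j c_L(n)) = 0 ↔ loc_v(2^j c_L(n/ℓ)) = 0`; coherent data at `n/ℓ ⊂ n`). [cite: McCallumLMS1991, §4 Prop. 4.4; §5 p. 310]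
[cite: GrossLMS1991, Prop. 6.2 (2)] -/
theorem zsmul_kolyvaginClass_two_mem_torsionLocalKer (hQ2 : KolyvaginRelationAtTwo) (hcm : ¬ W.HasCM)
    (hK : IsImaginaryQuadratic K) (hne3 : NumberField.discr K ≠ -3) (hne4 : NumberField.discr K ≠ -4)
    (hH : SatisfiesHeegnerHypothesis (W.conductorNorm ℤ) K) (hsur : ∀ m : ℕ, W.HasSurjectiveModNGaloisRep (2 ^ m : ℕ))
    {L : ℕ} (hL : 1 ≤ L) (j : ℕ) {n : ℕ} (hn : Squarefree n)
    (hKol : ∀ ℓ ∈ n.primeFactors, Zhang2014.IsKolyvaginPrime (W.conductorNorm ℤ) W K 2 ℓ ∧ L ≤ Zhang2014.kolyvaginIndex W 2 ℓ)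
    (d : KolyvaginHeegnerData Dt β ι n) {ℓ : ℕ} (hℓ : ℓ ∈ n.primeFactors) (dsub : KolyvaginHeegnerData Dt β ι (n / ℓ))
    (hσ : ∀ l' ∈ (n / ℓ).primeFactors, ∀ (x : ringClassField K ι (n / ℓ)) (x' : ringClassField K ι n),
      (x : ℂ) = x' → ((d.σ l' x' : ringClassField K ι n) : ℂ) = (dsub.σ l' x : ℂ))
    (hS : ∀ s ∈ dsub.S, ∃ s' ∈ d.S, ∀ (x : ringClassField K ι (n / ℓ)) (x' : ringClassField K ι n),
      (x : ℂ) = x' → ((s' x' : ringClassField K ι n) : ℂ) = (s x : ℂ))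
    (hS' : ∀ s' ∈ d.S, ∃ s ∈ dsub.S, ∀ (x : ringClassField K ι (n / ℓ)) (x' : ringClassField K ι n),
      (x : ℂ) = x' → ((s' x' : ringClassField K ι n) : ℂ) = (s x : ℂ))
    (hemb : ∀ (x : ringClassField K ι (n / ℓ)) (x' : ringClassField K ι n), (x : ℂ) = x' → d.emb x' = dsub.emb x)
    (hsub : ((2 ^ j : ℕ) : ℤ) • dsub.kolyvaginClass Nat.prime_two L = 0)
    (v : HeightOneSpectrum (𝓞 K)) (hv : ((ℓ : ℕ) : 𝓞 K) ∈ v.asIdeal) :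
    ((2 ^ j : ℕ) : ℤ) • d.kolyvaginClass Nat.prime_two L ∈
      (W.baseChange K).torsionLocalKer (v.adicCompletion K) ((2 ^ L : ℕ) : ℤ) := by
  have hℓp : ℓ.Prime := Nat.prime_of_mem_primeFactors hℓ
  have hℓn : ℓ ∣ n := Nat.dvd_of_mem_primeFactors hℓ
  have hN : n / ℓ * ℓ = n := Nat.div_mul_cancel hℓn
  have hlm : ¬ ℓ ∣ n / ℓ := fun h ↦ by
    have h2 : ℓ * ℓ ∣ n := by
      have h3 := Nat.mul_dvd_mul_left ℓ h
      rwa [Nat.mul_div_cancel' hℓn] at h3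
    exact hℓp.one_lt.ne' (Nat.isUnit_iff.mp (hn ℓ h2))
  have hQ := kolyvaginRelationAtTwo_of_mul_eq W Dt β ι hQ2 hcm hK hne3 hne4 hH hsur L hL hN hn hℓp hlm hKol dsub d hσ hS hS' hemb
    v hv j
  refine hQ.2.mpr ?_
  rw [hsub]
  exact AddSubgroup.zero_mem _

/-! ## §2 Prop. 5.2 at `2` in separation form ⟹ the avoidance binders -/

/-- **McCALLUM'S PROP. 5.2 AT `2`, SEPARATION FORM, IN THE TREE'S CURRENCY ⟹ the avoidance binder of the descent layer.** Hypothesis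
`hP52sep`: for every `C = ⟨u₁,…,u_i⟩ ⊔ C₀` (`i ≤ b` Selmer classes of sign `ε`) a square-free `n` of Kolyvagin primes of index `≥ L`, a
datum at `n` with coherent data at the `n/ℓ`, `2^{L−M'} c_L(n/ℓ) = 0`, `ord c_L(n) = 2^{L−k}`, sign `ε`, and the own primes of `n` SEPARATE
`C`: `C ⊓ ⨅_{ℓ∣n} ⨅_{v∣ℓ} ker(H¹(K,E_K[2^L]) → H¹(K_v,E_K[2^L])) = ⊥` — the output shape of the route's swap loop
(`exists_good_separating_of_swapOracle`). Conclusion: the avoidance binder at `(s, a) = (b+1, M'−k)` for sign `ε`, seed `C₀`.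
[cite: McCallumLMS1991, §5 Prop. 5.2 (proof, p. 310: «k = r»), Prop. 4.4] -/
theorem avoidance_of_kolyvaginSupply_of_separation (hQ2 : KolyvaginRelationAtTwo) (hcm : ¬ W.HasCM)
    (hK : IsImaginaryQuadratic K) (hne3 : NumberField.discr K ≠ -3) (hodd' : Odd (NumberField.discr K))
    (hH : SatisfiesHeegnerHypothesis (W.conductorNorm ℤ) K) (hodd : Odd W.tamagawaProduct)
    (hsur : ∀ m : ℕ, W.HasSurjectiveModNGaloisRep (2 ^ m : ℕ)) (hτ : τ ≠ 1)
    (ε : ℤ) {M' k b : ℕ} (hL : 1 ≤ L) (hkM : k ≤ M') (hML : M' ≤ L)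
    (C₀ : AddSubgroup (galH1Torsion (W.baseChange K) ((2 ^ L : ℕ) : ℤ)))
    (hP52sep : ∀ (i : ℕ) (u : Fin i → galH1Torsion (W.baseChange K) ((2 ^ L : ℕ) : ℤ)), i ≤ b →
      (∀ j, u j ∈ selmerGroup (W.baseChange K) ((2 ^ L : ℕ) : ℤ) ∧ conjAct W τ ((2 ^ L : ℕ) : ℤ) (u j) = ε • u j) →
      ∃ (n : ℕ) (_ : Squarefree n)
        (_ : ∀ ℓ ∈ n.primeFactors, Zhang2014.IsKolyvaginPrime (W.conductorNorm ℤ) W K 2 ℓ ∧ L ≤ Zhang2014.kolyvaginIndex W 2 ℓ)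
        (d : KolyvaginHeegnerData Dt β ι n) (dsub : ∀ ℓ ∈ n.primeFactors, KolyvaginHeegnerData Dt β ι (n / ℓ)),
        (∀ ℓ (hℓ : ℓ ∈ n.primeFactors), ∀ l' ∈ (n / ℓ).primeFactors,
          ∀ (x : ringClassField K ι (n / ℓ)) (x' : ringClassField K ι n),
          (x : ℂ) = x' → ((d.σ l' x' : ringClassField K ι n) : ℂ) = ((dsub ℓ hℓ).σ l' x : ℂ)) ∧
        (∀ ℓ (hℓ : ℓ ∈ n.primeFactors), ∀ s ∈ (dsub ℓ hℓ).S, ∃ s' ∈ d.S,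
          ∀ (x : ringClassField K ι (n / ℓ)) (x' : ringClassField K ι n),
          (x : ℂ) = x' → ((s' x' : ringClassField K ι n) : ℂ) = (s x : ℂ)) ∧
        (∀ ℓ (hℓ : ℓ ∈ n.primeFactors), ∀ s' ∈ d.S, ∃ s ∈ (dsub ℓ hℓ).S,
          ∀ (x : ringClassField K ι (n / ℓ)) (x' : ringClassField K ι n),
          (x : ℂ) = x' → ((s' x' : ringClassField K ι n) : ℂ) = (s x : ℂ)) ∧
        (∀ ℓ (hℓ : ℓ ∈ n.primeFactors), ∀ (x : ringClassField K ι (n / ℓ)) (x' : ringClassField K ι n),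
          (x : ℂ) = x' → d.emb x' = (dsub ℓ hℓ).emb x) ∧
        (∀ ℓ (hℓ : ℓ ∈ n.primeFactors), ((2 ^ (L - M') : ℕ) : ℤ) • (dsub ℓ hℓ).kolyvaginClass Nat.prime_two L = 0) ∧
        addOrderOf (d.kolyvaginClass Nat.prime_two L) = 2 ^ (L - k) ∧
        -W.rootNumber * (-1) ^ n.primeFactors.card = ε ∧
        (AddSubgroup.closure (Set.range u) ⊔ C₀) ⊓
          (⨅ ℓ ∈ n.primeFactors, ⨅ (v : HeightOneSpectrum (𝓞 K)) (_ : ((ℓ : ℕ) : 𝓞 K) ∈ v.asIdeal),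
            (W.baseChange K).torsionLocalKer (v.adicCompletion K) ((2 ^ L : ℕ) : ℤ)) = ⊥) :
    ∀ i < b + 1, ∀ u : Fin i → galH1Torsion (W.baseChange K) ((2 ^ L : ℕ) : ℤ),
      (∀ j, u j ∈ selmerGroup (W.baseChange K) ((2 ^ L : ℕ) : ℤ) ∧ conjAct W τ ((2 ^ L : ℕ) : ℤ) (u j) = ε • u j) →
      (∀ j, addOrderOf (u j) = 2 ^ (M' - k)) →
      ∃ y : galH1Torsion (W.baseChange K) ((2 ^ L : ℕ) : ℤ),
        (y ∈ selmerGroup (W.baseChange K) ((2 ^ L : ℕ) : ℤ) ∧ conjAct W τ ((2 ^ L : ℕ) : ℤ) y = ε • y) ∧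
        addOrderOf y = 2 ^ (M' - k) ∧ Disjoint (zmultiples y) (AddSubgroup.closure (Set.range u) ⊔ C₀) := by
  have hne4 : NumberField.discr K ≠ -4 := fun h ↦ by
    rw [h] at hodd'
    exact (Int.not_even_iff_odd.mpr hodd') ⟨-2, by norm_num⟩
  intro i hi u hu _
  obtain ⟨n, hn, hKol, d, dsub, hσ, hS, hS', hemb, hsub, hordc, hsign, hsep⟩ := hP52sep i u (Nat.lt_succ_iff.mp hi) hu
  obtain ⟨y, hy, hysel, hyτ, -, hyord, -⟩ := exists_supplyElement_of_kolyvaginDatum W Dt β ι hQ2 hcm hK hne3 hodd' hH hodd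
    hsur τ hτ hL hkM hML hn hKol d dsub hσ hS hS' hemb hsub hordc
  refine ⟨y, ⟨hysel, by rw [hyτ, hsign]⟩, hyord, ?_⟩
  -- separation ⟹ avoidance, the supply element vanishing at the own primes
  refine disjoint_zmultiples_of_forall_mem (AddSubgroup.closure (Set.range u) ⊔ C₀)
    (fun ℓ ↦ ⨅ (v : HeightOneSpectrum (𝓞 K)) (_ : ((ℓ : ℕ) : 𝓞 K) ∈ v.asIdeal),
      (W.baseChange K).torsionLocalKer (v.adicCompletion K) ((2 ^ L : ℕ) : ℤ)) n.primeFactors hsep fun ℓ hℓ ↦ ?_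
  rw [AddSubgroup.mem_iInf]
  intro v
  rw [AddSubgroup.mem_iInf]
  intro hv
  rw [hy]
  exact zsmul_kolyvaginClass_two_mem_torsionLocalKer W Dt β ι hQ2 hcm hK hne3 hne4 hH hsur hL (L - M') hn hKol d hℓ (dsub ℓ hℓ)
    (hσ ℓ hℓ) (hS ℓ hℓ) (hS' ℓ hℓ) (hemb ℓ hℓ) (hsub ℓ hℓ) v hv

end Summit.BirchSwinnertonDyer.BirchSwinnertonDyer.Theorems.GenusExact.PlusDescent

end
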